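import Summits.CriticalPhenomena.PercolationContinuityZ3.Theorems.Transplant.SkelPhiForcedKitDefs
import HarnessLib

/-!
# N2 (frames-only node `SamePDropOfSkeletonFrm₁`, OPEN), (S0) kit tier, Skel side — J12 REPAIR, part 1a: **PLACEMENT OF THE COLUMN END**
# (the `ctColEnd` twins of the `ctCtr` placement lemmas; consumed by `SkelPhiForcedKitDefsC` = part 1b: `forcedGeomC`, `kitOK_forcedC`)

J12 (stmt-g20 2026-08-23T03:04:23Z, kernel certificate `kitZoneRows_absurd`; lead g11 03:05:11Z/03:06:24Z; p1-g17 03:09:30Z/03:12:38Z): in `kitOK_forced`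
the zone datum sits about N1's CHOSEN centre `ctCtr x = colPt …` (a `Classical.choose` over the kit point), so the row `hcol` (the column's END in the zone)
needed `Λc ⊇ cylBallFin c kz Rk`, `Rk ≥ cylRadMax types kz (2·KCmax)` — jointly unsatisfiable with `Λc ⊆ Rg ⊆ B_G(c, Rs)`, `Rs + 1 ≤ shellD ≤ KCmax`.
REPAIR (B) 're-centre': the column end `ctColEnd x` (SkelPhiForcedColumn) satisfies the SAME two facts as `ctCtr x` — `φ (ctColEnd x) = kitPt …`
(`φ_ctColEnd`) and `ctColEnd x ∈ B_G(t₁, kitK …)` (`walk_mem_graphBall`) — so every placement lemma holds for it with the same proof (§1), and with the zone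
datum ABOUT THE COLUMN END the column row is the zone's own `c ∈ Λc c kz` (§3: `hcol` ↦ `hcz`; NO `cylRadMax`/`cylBallFin`/`Frames`/`CylConn` row).
The order of constants becomes acyclic: LEVEL 0 fixes `(kz, Λc, Rs := graph extent of Λc)`, then `shellD ≥ Rs + 1`, then `KCmax`, then `A, tanOff, cU, cS, rs, r₀`.
builds on p205010 (kernel theorem, internal audit signed; external expert review pending) — nothing in this file uses p205010; nothing here is a
claim about the open node `SamePDropOfSkeletonFrm₁`.
Lane `prim-bschramm`, seat `prim-bschramm-p1` (gen 17); helper file (`--supports stmt-CriticalPhenomena-4575 --as helper`).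
* `ctColEnd_mem_graphBall_kitK`, `le_lin_ctColEnd`, `shellD_le_sdepth_ctColEnd'`, `ball_ctColEnd_facts`, `ball_ctColEnd_subset_winLevel`, `ctColEnd_reach`,
  `ψ_ctColEnd_mem_Icc` — twins of the `ctCtr` lemmas of SkelPhiApronKitDefs / SkelPhiApronCapture / SkelPhiKitsAStepIV / SkelPhiRunKits, SAME proofs with
  `colPt_spec ↦ (φ_ctColEnd, walk_mem_graphBall)`.
[cite: KozmaNitzan2024, §4 Lemma 10, p. 19 (Step III: seeds), p. 26 ((29): columns)] [cite: GrimmettPercolation1999, §7.2]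
-/

noncomputable section

open scoped Classical

namespace Summit.CriticalPhenomena.PercolationContinuityZ3.Theorems.Transplant

namespace Skelφ

open MeasureTheory
open Literature.Probability.Percolation Literature.Probability.LatticeModels SimpleGraph KNLevels
open Literature.Probability.Percolation.KozmaNitzan.Cells (oth oth_ne eq_oth_of_ne oth_oth)
open Literature.Barriers.CriticalPhenomena (graphBall graphBall_finite mem_graphBall_self graphBall_mono)
open Skel (winGraph winGraph_adj winGraph_le KitGeom)
open SkelI (tanOff tanTgt tanTgt_mem)

variable {V : Type} [DecidableEq V] {G : SimpleGraph V} [G.LocallyFinite] {ψ φ : V → Site 2}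

/-! ## §1 Placement of the column end (the two spec facts and their consequences) -/

section PlaceE

variable {w₀ : V} {R : ℕ} {Lo Hi : Site 2} (SF : ∀ (i : Fin 2) (σ : ℤˣ), SideForm ψ φ Lo Hi i σ) {P : ApronPrm} {KCmax ρ : ℕ}

omit [DecidableEq V] [G.LocallyFinite] in
/-- **Spec fact 2**: the column end is within graph distance `kitK` of the stem end (under `Steps`). [folklore] -/
theorem ctColEnd_mem_graphBall_kitK (hstep : Steps G φ) (x : V) :
    ctColEnd G SF P w₀ R x ∈ graphBall G (ctT1 G ψ P w₀ R Lo Hi x)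
      ((SF (ctDir G ψ w₀ R Lo Hi x).1 (ctDir G ψ w₀ R Lo Hi x).2).kitK (φ (ctT1 G ψ P w₀ R Lo Hi x)) (shellD P) P.A) := by
  unfold ctColEnd; exact walk_mem_graphBall hstep _ _ _ _

omit [DecidableEq V] [G.LocallyFinite] in
/-- **Spec fact 1** (form value): the exit side form at the column end is at least `θ D + A`. [folklore] -/
theorem le_lin_ctColEnd (hstep : Steps G φ) {x : V}
    (ht : (SF (ctDir G ψ w₀ R Lo Hi x).1 (ctDir G ψ w₀ R Lo Hi x).2).lin (φ (ctT1 G ψ P w₀ R Lo Hi x)) ≤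
      (SF (ctDir G ψ w₀ R Lo Hi x).1 (ctDir G ψ w₀ R Lo Hi x).2).θ (shellD P) + P.A) :
    (SF (ctDir G ψ w₀ R Lo Hi x).1 (ctDir G ψ w₀ R Lo Hi x).2).θ (shellD P) + P.A ≤
      (SF (ctDir G ψ w₀ R Lo Hi x).1 (ctDir G ψ w₀ R Lo Hi x).2).lin (φ (ctColEnd G SF P w₀ R x)) := by
  rw [φ_ctColEnd hstep x]; exact le_lin_ctCtr SF hstep ht

/-- The column end of a contact sits at depth `≥ D` (`θ (2+d) ≤ θ D + A`, `A ≥ 0`). [folklore] -/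
theorem shellD_le_sdepth_ctColEnd' (hlip : Lip G ψ) (hq : QStepsN G ψ P.N) (hstep : Steps G φ) (hw2 : ∀ i, Lo i + 2 ≤ Hi i) (hA : 0 ≤ P.A)
    (hθA : ∀ (i : Fin 2) (σ : ℤˣ), (SF i σ).θ (2 + P.d) ≤ (SF i σ).θ (shellD P) + P.A)
    {x : V} (hx : x ∈ outerBoundary (winGraph G w₀ R) (Win G ψ w₀ (Finset.Icc Lo Hi) R)) :
    (shellD P : ℤ) ≤ sdepth ψ Lo Hi (ctDir G ψ w₀ R Lo Hi x).1 (ctDir G ψ w₀ R Lo Hi x).2 (ctColEnd G SF P w₀ R x) := by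
  have ht := ψ_ctT1 hlip hq hw2 hx
  have hzlt := (SF (ctDir G ψ w₀ R Lo Hi x).1 (ctDir G ψ w₀ R Lo Hi x).2).lin_lt_of_sdepth_lt (φ := φ) (v := ctT1 G ψ P w₀ R Lo Hi x)
    (m := 2 + P.d) (by rw [ht.1]; omega)
  exact (SF _ _).le_sdepth_of_lin (by
    have h1 := le_lin_ctColEnd SF hstep (x := x) (by have := hθA (ctDir G ψ w₀ R Lo Hi x).1 (ctDir G ψ w₀ R Lo Hi x).2; linarith)
    linarith)

/-- **The ball of radius `ρ` about the COLUMN END of a near contact** (twin of `ball_ctCtr_facts`, same proof over the two spec facts): (a) inside `B_G(w₀, R)`, (b) tangentially at least `D` inside, (c) at depth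
between `D − ρ` and `(Hi − Lo) − D` behind the exit side. [this work] -/
theorem ball_ctColEnd_facts (hlip : Lip G ψ) (hq : QStepsN G ψ P.N) (hstep : Steps G φ) (hwide : ∀ i, Lo i + 2 * tanOff P.ℓs P.M ≤ Hi i)
    (hKC : ∀ (i : Fin 2) (σ : ℤˣ) (z : Site 2), (SF i σ).θ (1 + P.d) ≤ (SF i σ).lin z → (SF i σ).lin z < (SF i σ).θ (2 + P.d) →
      (SF i σ).kitK z (shellD P) P.A ≤ KCmax)
    (hA : 0 ≤ P.A) (hθA : ∀ (i : Fin 2) (σ : ℤˣ), (SF i σ).θ (2 + P.d) ≤ (SF i σ).θ (shellD P) + P.A)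
    (hr₀ : P.N * (tanOff P.ℓs P.M + 1) + P.N * P.d + (KCmax + ρ) ≤ P.r₀) (hR : P.r₀ ≤ R)
    (hT : (shellD P : ℤ) + KCmax + ρ ≤ tanOff P.ℓs P.M) (hDw : ∀ i, Lo i + ((shellD P + 1 + P.d + KCmax + ρ : ℕ) : ℤ) ≤ Hi i)
    {x : V} (hx : x ∈ outerBoundary (winGraph G w₀ R) (Win G ψ w₀ (Finset.Icc Lo Hi) R)) (hnear : IsNear G ψ Lo Hi P w₀ R x)
    {v : V} (hv : v ∈ graphBall G (ctColEnd G SF P w₀ R x) ρ) :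
    v ∈ graphBall G w₀ R ∧
      (Lo (oth (ctDir G ψ w₀ R Lo Hi x).1) + shellD P ≤ ψ v (oth (ctDir G ψ w₀ R Lo Hi x).1) ∧
        ψ v (oth (ctDir G ψ w₀ R Lo Hi x).1) ≤ Hi (oth (ctDir G ψ w₀ R Lo Hi x).1) - shellD P) ∧
      (shellD P : ℤ) - ρ ≤ sdepth ψ Lo Hi (ctDir G ψ w₀ R Lo Hi x).1 (ctDir G ψ w₀ R Lo Hi x).2 v ∧
      sdepth ψ Lo Hi (ctDir G ψ w₀ R Lo Hi x).1 (ctDir G ψ w₀ R Lo Hi x).2 v ≤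
        Hi (ctDir G ψ w₀ R Lo Hi x).1 - Lo (ctDir G ψ w₀ R Lo Hi x).1 - shellD P := by
  have hw2 : ∀ i, Lo i + 2 ≤ Hi i := fun i => by have := hwide i; unfold tanOff at this; omega
  have ht := ψ_ctT1 hlip hq hw2 hx
  have hzge := (SF (ctDir G ψ w₀ R Lo Hi x).1 (ctDir G ψ w₀ R Lo Hi x).2).le_lin_of_le_sdepth (φ := φ) (v := ctT1 G ψ P w₀ R Lo Hi x)
    (m := 1 + P.d) (by rw [ht.1])
  have hzlt := (SF (ctDir G ψ w₀ R Lo Hi x).1 (ctDir G ψ w₀ R Lo Hi x).2).lin_lt_of_sdepth_lt (φ := φ) (v := ctT1 G ψ P w₀ R Lo Hi x)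
    (m := 2 + P.d) (by rw [ht.1]; omega)
  -- distances
  have hct : ctColEnd G SF P w₀ R x ∈ graphBall G (ctT1 G ψ P w₀ R Lo Hi x) KCmax :=
    graphBall_mono G _ (hKC _ _ _ hzge hzlt) (ctColEnd_mem_graphBall_kitK SF (P := P) (w₀ := w₀) (R := R) hstep x)
  have hvt : v ∈ graphBall G (ctT1 G ψ P w₀ R Lo Hi x) (KCmax + ρ) := BoxProdZ2.mem_graphBall_add G hct hv
  have hvy : v ∈ graphBall G (ctY G ψ w₀ R Lo Hi x) (P.N * (tanOff P.ℓs P.M + 1) + P.N * P.d + (KCmax + ρ)) :=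
    BoxProdZ2.mem_graphBall_add G (ctT1_mem_graphBall hq hwide hx) hvt
  refine ⟨?_, ?_, ?_, ?_⟩
  · have h := BoxProdZ2.mem_graphBall_add G hnear (graphBall_mono G _ hr₀ hvy)
    rwa [Nat.sub_add_cancel hR] at h
  · have h := abs_sub_le_of_mem_graphBall hlip hvt (oth (ctDir G ψ w₀ R Lo Hi x).1)
    rw [ht.2, abs_le] at h
    have hτ := tanTgt_mem (oth (ctDir G ψ w₀ R Lo Hi x).1) (hwide (oth _)) (ψ (ctY G ψ w₀ R Lo Hi x))
    push_cast at h
    constructor <;> linarith [h.1, h.2, hτ.1, hτ.2]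
  · have hc := shellD_le_sdepth_ctColEnd' SF hlip hq hstep hw2 hA hθA hx
    have h := sdepth_sub_le_of_mem_graphBall hlip (Lo := Lo) (Hi := Hi) (ctDir G ψ w₀ R Lo Hi x).1 (ctDir G ψ w₀ R Lo Hi x).2 hv
    rw [abs_le] at h; linarith [h.1]
  · have h := sdepth_sub_le_of_mem_graphBall hlip (Lo := Lo) (Hi := Hi) (ctDir G ψ w₀ R Lo Hi x).1 (ctDir G ψ w₀ R Lo Hi x).2 hvt
    rw [ht.1, abs_le] at h
    have hwid := hDw (ctDir G ψ w₀ R Lo Hi x).1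
    push_cast at h hwid ⊢
    linarith [h.2]

end PlaceE

/-- **The ball of radius `ρ` about the column end of a near contact lies in the window level** (twin of `ball_ctCtr_subset_winLevel`) (`D ≥ ρ + 1`; placement radii). [folklore] -/
theorem ball_ctColEnd_subset_winLevel {lo hi : Site 2} {j : ℕ} {w₀ : V} {R : ℕ}
    (SF : ∀ (i : Fin 2) (σ : ℤˣ), SideForm ψ φ (lo - (j : Site 2)) (hi + (j : Site 2)) i σ) {P : ApronPrm} {KCmax ρ : ℕ}
    (hlip : Lip G ψ) (hq : QStepsN G ψ P.N) (hstep : Steps G φ) (hwide : ∀ i, (lo - (j : Site 2)) i + 2 * tanOff P.ℓs P.M ≤ (hi + (j : Site 2)) i)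
    (hKC : ∀ (i : Fin 2) (σ : ℤˣ) (z : Site 2), (SF i σ).θ (1 + P.d) ≤ (SF i σ).lin z → (SF i σ).lin z < (SF i σ).θ (2 + P.d) →
      (SF i σ).kitK z (shellD P) P.A ≤ KCmax)
    (hA : 0 ≤ P.A) (hθA : ∀ (i : Fin 2) (σ : ℤˣ), (SF i σ).θ (2 + P.d) ≤ (SF i σ).θ (shellD P) + P.A)
    (hr₀ : P.N * (tanOff P.ℓs P.M + 1) + P.N * P.d + (KCmax + ρ) ≤ P.r₀) (hR : P.r₀ ≤ R)
    (hT : (shellD P : ℤ) + KCmax + ρ ≤ tanOff P.ℓs P.M)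
    (hDw : ∀ i, (lo - (j : Site 2)) i + ((shellD P + 1 + P.d + KCmax + ρ : ℕ) : ℤ) ≤ (hi + (j : Site 2)) i) (hDρ : ρ + 1 ≤ shellD P)
    {x : V} (hx : x ∈ outerBoundary (winGraph G w₀ R) (winLevel G ψ w₀ R lo hi j))
    (hnear : IsNear G ψ (lo - (j : Site 2)) (hi + (j : Site 2)) P w₀ R x) :
    ∀ v ∈ graphBall G (ctColEnd G SF P w₀ R x) ρ, v ∈ winLevel G ψ w₀ R lo hi j := by
  intro v hv
  obtain ⟨hball, htan, hlow, htop⟩ := ball_ctColEnd_facts SF hlip hq hstep hwide hKC hA hθA hr₀ hR hT hDw hx hnear hv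
  unfold winLevel
  rw [mem_Win, Finset.mem_Icc]
  refine ⟨hball, ?_, ?_⟩ <;> intro i
  · by_cases hi : i = (ctDir G ψ w₀ R (lo - (j : Site 2)) (hi + (j : Site 2)) x).1
    · rw [hi]; unfold sdepth at hlow htop; split_ifs at hlow htop <;> push_cast at hlow htop hDρ ⊢ <;> omega
    · rw [eq_oth_of_ne hi]; have := htan.1; push_cast at this ⊢; omega
  · by_cases hi : i = (ctDir G ψ w₀ R (lo - (j : Site 2)) (hi + (j : Site 2)) x).1
    · rw [hi]; unfold sdepth at hlow htop; split_ifs at hlow htop <;> push_cast at hlow htop hDρ ⊢ <;> omega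
    · rw [eq_oth_of_ne hi]; have := htan.2; push_cast at this ⊢; omega

/-- **The column end is within `N(T₀+1) + N·d + KCmax` of the inner neighbour.** [folklore] -/
theorem ctColEnd_reach {w₀ : V} {R : ℕ} {Lo Hi : Site 2} (SF : ∀ (i : Fin 2) (σ : ℤˣ), SideForm ψ φ Lo Hi i σ) {P : ApronPrm} {KCmax : ℕ}
    (hlip : Lip G ψ) (hq : QStepsN G ψ P.N) (hstep : Steps G φ) (hwide : ∀ i, Lo i + 2 * tanOff P.ℓs P.M ≤ Hi i)
    (hKC : ∀ (i : Fin 2) (σ : ℤˣ) (z : Site 2), (SF i σ).θ (1 + P.d) ≤ (SF i σ).lin z → (SF i σ).lin z < (SF i σ).θ (2 + P.d) →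
      (SF i σ).kitK z (shellD P) P.A ≤ KCmax)
    {x : V} (hx : x ∈ outerBoundary (winGraph G w₀ R) (Win G ψ w₀ (Finset.Icc Lo Hi) R)) :
    ctColEnd G SF P w₀ R x ∈ graphBall G (ctY G ψ w₀ R Lo Hi x) (P.N * (tanOff P.ℓs P.M + 1) + P.N * P.d + KCmax) := by
  have hw2 : ∀ i, Lo i + 2 ≤ Hi i := fun i => by have := hwide i; unfold tanOff at this; omega
  have ht := ψ_ctT1 hlip hq hw2 hx
  have hzge := (SF (ctDir G ψ w₀ R Lo Hi x).1 (ctDir G ψ w₀ R Lo Hi x).2).le_lin_of_le_sdepth (φ := φ) (v := ctT1 G ψ P w₀ R Lo Hi x)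
    (m := 1 + P.d) (by rw [ht.1])
  have hzlt := (SF (ctDir G ψ w₀ R Lo Hi x).1 (ctDir G ψ w₀ R Lo Hi x).2).lin_lt_of_sdepth_lt (φ := φ) (v := ctT1 G ψ P w₀ R Lo Hi x)
    (m := 2 + P.d) (by rw [ht.1]; omega)
  have hct : ctColEnd G SF P w₀ R x ∈ graphBall G (ctT1 G ψ P w₀ R Lo Hi x) KCmax :=
    graphBall_mono G _ (hKC _ _ _ hzge hzlt) (ctColEnd_mem_graphBall_kitK SF (P := P) (w₀ := w₀) (R := R) hstep x)
  exact BoxProdZ2.mem_graphBall_add G (ctT1_mem_graphBall hq hwide hx) hct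

/-- **The frame image of the column end lies in the `j + reach`-enlargement of the level box.** [folklore] -/
theorem ψ_ctColEnd_mem_Icc {w₀ : V} {R : ℕ} {lo hi : Site 2} {j : ℕ}
    (SF : ∀ (i : Fin 2) (σ : ℤˣ), SideForm ψ φ (lo - (j : Site 2)) (hi + (j : Site 2)) i σ) {P : ApronPrm} {KCmax E : ℕ}
    (hlip : Lip G ψ) (hq : QStepsN G ψ P.N) (hstep : Steps G φ) (hwide : ∀ i, (lo - (j : Site 2)) i + 2 * tanOff P.ℓs P.M ≤ (hi + (j : Site 2)) i)
    (hKC : ∀ (i : Fin 2) (σ : ℤˣ) (z : Site 2), (SF i σ).θ (1 + P.d) ≤ (SF i σ).lin z → (SF i σ).lin z < (SF i σ).θ (2 + P.d) →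
      (SF i σ).kitK z (shellD P) P.A ≤ KCmax)
    (hE : j + (P.N * (tanOff P.ℓs P.M + 1) + P.N * P.d + KCmax) ≤ E)
    {x : V} (hx : x ∈ outerBoundary (winGraph G w₀ R) (winLevel G ψ w₀ R lo hi j)) :
    ψ (ctColEnd G SF P w₀ R x) ∈ Finset.Icc (lo - ((E : ℕ) : Site 2)) (hi + ((E : ℕ) : Site 2)) := by
  have hy := ctY_mem_Icc (G := G) (ψ := ψ) (w₀ := w₀) (R := R) hx
  have hd := ctColEnd_reach SF hlip hq hstep hwide hKC hx
  rw [Finset.mem_Icc] at hy ⊢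
  constructor <;> intro i
  · have h1 := abs_sub_le_of_mem_graphBall hlip hd i
    have h2 := hy.1 i
    rw [abs_le] at h1
    simp only [Pi.sub_apply, Pi.natCast_apply] at h2 ⊢
    push_cast at h1 h2 ⊢
    have : (j : ℤ) + (P.N * (tanOff P.ℓs P.M + 1) + P.N * P.d + KCmax : ℕ) ≤ E := by exact_mod_cast hE
    push_cast at this
    linarith [h1.1]
  · have h1 := abs_sub_le_of_mem_graphBall hlip hd i
    have h2 := hy.2 i
    rw [abs_le] at h1
    simp only [Pi.add_apply, Pi.natCast_apply] at h2 ⊢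
    push_cast at h1 h2 ⊢
    have : (j : ℤ) + (P.N * (tanOff P.ℓs P.M + 1) + P.N * P.d + KCmax : ℕ) ≤ E := by exact_mod_cast hE
    push_cast at this
    linarith [h1.2]

end Skelφ

end Summit.CriticalPhenomena.PercolationContinuityZ3.Theorems.Transplant

end
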